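import Mathlib.MeasureTheory.Measure.Tilted
import Mathlib.MeasureTheory.Function.L2Space
import Mathlib.Analysis.SpecialFunctions.Pow.Real
import Mathlib.Analysis.SpecialFunctions.ExpDeriv
import Mathlib.Analysis.Calculus.Deriv.MeanValue
import Literature.MathematicalPhysics.QuantumFieldTheory.Balaban1983to89.Beta.TransportVertices
import HarnessLib

/-!
# Second-order expansion of a tilted covariance — preliminaries
# (for the registered stub A `stub_tiltedCovSecondOrder : TiltedCovSecondOrder` of LINE-17 «hypercontractive second-order
# tilt expansion» on crux `AllWindowsColdBox.BoxMidWindowsSU22`, stmt-QuantumFields-24003; companion file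
# `AllWindowsColdBoxTiltedCovSecondOrder.lean`)

Elementary real analysis used by the tilted-covariance estimate, kept in a separate module:
1. the sharp exponential remainder `0 ≤ e^t − 1 − t ≤ (t²/2)·e^{|t|}` (`exp_sub_one_sub_le`; the half-line `t ≥ 0` is the
   tree's `Beta.TransportVertices.expTail_two_le`, the half-line `t ≤ 0` one monotonicity argument);
2. the square-root-free Cauchy–Schwarz inequality `(∫ φψ)² ≤ ∫ φ² ∫ ψ²` and the variance inequality `(∫ h)² ≤ ∫ h²`,
   with free output shapes, plus `L²·L² ⊆ L¹` glue (`memLp_two_of_sq_eq`, `integrable_mul_of_memLp_two`);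
3. the pure real-variable bookkeeping of the estimate (`abs_expansion_le`, `tiltedCov_bookkeeping`: from the squared
   Cauchy–Schwarz relations between the moments to the constant `15/4 ≤ 4`), stated over real variables so that no
   nonlinear arithmetic runs inside the measure-theoretic context.
Mathlib only.  [folklore]

HONEST LABEL: calculus/arithmetic helpers for ONE registered M-stub of two lines on the R2ξ″ RECORD-rung cruxes
24003/24006; no crux, rung or summit is proved; the Yang–Mills mass gap is NOT proved by this file.
-/

set_option autoImplicit false

noncomputable section

open MeasureTheory
open Literature.MathematicalPhysics.QuantumFieldTheory.Balaban1983to89.Beta.TransportVertices (expTail_two expTail_two_le)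

namespace Summit.QuantumFields.YangMills.Theorems.AllWindowsColdBoxTiltedCov

/-! ## 1. The sharp exponential remainder `0 ≤ e^t − 1 − t ≤ (t²/2)·e^{|t|}` -/

/-- `0 ≤ e^t − 1 − t`. -/
theorem exp_sub_one_sub_nonneg (t : ℝ) : 0 ≤ Real.exp t - 1 - t := by
  have := Real.add_one_le_exp t
  linarith

/-- For `s ≥ 0`: `e^{−s} − 1 + s ≤ (s²/2) e^{s}`. -/
theorem exp_neg_sub_one_add_le_of_nonneg {s : ℝ} (hs : 0 ≤ s) :
    Real.exp (-s) - 1 + s ≤ s ^ 2 / 2 * Real.exp s := by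
  have hderiv : ∀ u : ℝ, HasDerivAt (fun x : ℝ => x * x / 2 * Real.exp x - Real.exp (-x) + 1 - x)
      (u * Real.exp u + u * u / 2 * Real.exp u + Real.exp (-u) - 1) u := by
    intro u
    have h1 : HasDerivAt (fun x : ℝ => x * x / 2) ((1 * u + u * 1) / 2) u :=
      ((hasDerivAt_id' u).fun_mul (hasDerivAt_id' u)).div_const 2
    have h2 : HasDerivAt Real.exp (Real.exp u) u := Real.hasDerivAt_exp u
    have h3 : HasDerivAt (fun x : ℝ => Real.exp (-x)) (Real.exp (-u) * -1) u :=
      (Real.hasDerivAt_exp (-u)).comp u (hasDerivAt_neg u)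
    have h4 := ((((h1.fun_mul h2).fun_sub h3).fun_add (hasDerivAt_const u (1 : ℝ))).fun_sub
      (hasDerivAt_id' u))
    refine h4.congr_deriv ?_
    ring
  have hmono : MonotoneOn (fun x : ℝ => x * x / 2 * Real.exp x - Real.exp (-x) + 1 - x) (Set.Ici 0) := by
    refine monotoneOn_of_hasDerivWithinAt_nonneg (convex_Ici 0)
      (fun u _ => (hderiv u).continuousAt.continuousWithinAt)
      (fun u _ => (hderiv u).hasDerivWithinAt) ?_
    intro u hu
    rw [interior_Ici] at hu
    have hu0 : 0 ≤ u := le_of_lt hu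
    have he1 : 1 ≤ Real.exp u := Real.one_le_exp hu0
    have he2 : -u + 1 ≤ Real.exp (-u) := Real.add_one_le_exp (-u)
    have hmul : u ≤ u * Real.exp u := by nlinarith
    nlinarith [sq_nonneg u, Real.exp_pos u]
  have hle := hmono (Set.self_mem_Ici) hs hs
  simp only [mul_zero, zero_div, zero_mul, neg_zero, Real.exp_zero, sub_zero] at hle
  have : s * s = s ^ 2 := by ring
  rw [this] at hle
  linarith

/-- The sharp second-order exponential remainder: `e^t − 1 − t ≤ (t²/2)·e^{|t|}` for every real `t` (the half-line `t ≥ 0`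
is the tree's `Beta.TransportVertices.expTail_two_le`, the half-line `t ≤ 0` is `exp_neg_sub_one_add_le_of_nonneg`). -/
theorem exp_sub_one_sub_le (t : ℝ) : Real.exp t - 1 - t ≤ t ^ 2 / 2 * Real.exp |t| := by
  rcases le_or_gt 0 t with ht | ht
  · rw [abs_of_nonneg ht]
    have h := expTail_two_le ht
    rwa [expTail_two] at h
  · have hs : 0 ≤ -t := by linarith
    have h := exp_neg_sub_one_add_le_of_nonneg hs
    rw [abs_of_neg ht]
    rw [neg_neg, neg_pow_two] at h
    linarith

/-- `|e^t − 1 − t| ≤ (t²/2)·e^{|t|}`. -/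
theorem abs_exp_sub_one_sub_le (t : ℝ) : |Real.exp t - 1 - t| ≤ t ^ 2 / 2 * Real.exp |t| := by
  rw [abs_of_nonneg (exp_sub_one_sub_nonneg t)]
  exact exp_sub_one_sub_le t


/-! ## 2. Square-root-free Cauchy–Schwarz and the variance inequality -/

section Integrals

variable {Ω : Type*} [MeasurableSpace Ω] {ν : Measure Ω}

/-- **Cauchy–Schwarz, squared form** `(∫ φψ)² ≤ (∫ φ₂)(∫ ψ₂)` whenever `φ² = φ₂`, `ψ² = ψ₂` pointwise and `φ₂, ψ₂, φψ` are
integrable (from `0 ≤ ∫ (sφ − tψ)²`; the shapes `φ₂, ψ₂` are free so that the output needs no rewriting). -/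
theorem sq_integral_mul_le {φ ψ φ₂ ψ₂ : Ω → ℝ} (hφ₂ : ∀ x, φ x ^ 2 = φ₂ x) (hψ₂ : ∀ x, ψ x ^ 2 = ψ₂ x)
    (hφ : Integrable φ₂ ν) (hψ : Integrable ψ₂ ν) (hφψ : Integrable (fun x => φ x * ψ x) ν) :
    (∫ x, φ x * ψ x ∂ν) ^ 2 ≤ (∫ x, φ₂ x ∂ν) * ∫ x, ψ₂ x ∂ν := by
  have key : ∀ s t : ℝ, 0 ≤ s ^ 2 * (∫ x, φ₂ x ∂ν) - 2 * s * t * (∫ x, φ x * ψ x ∂ν) +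
      t ^ 2 * ∫ x, ψ₂ x ∂ν := by
    intro s t
    have hnn : 0 ≤ ∫ x, (s * φ x - t * ψ x) ^ 2 ∂ν := integral_nonneg fun x => sq_nonneg _
    have e : ∀ x, (s * φ x - t * ψ x) ^ 2 =
        s ^ 2 * φ₂ x - 2 * s * t * (φ x * ψ x) + t ^ 2 * ψ₂ x := fun x => by
      rw [← hφ₂, ← hψ₂]; ring
    simp_rw [e] at hnn
    rw [integral_add, integral_sub, integral_const_mul, integral_const_mul, integral_const_mul] at hnn
    · exact hnn
    all_goals first
      | exact (hφ.const_mul _).sub (hφψ.const_mul _)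
      | exact hψ.const_mul _
      | exact hφψ.const_mul _
      | exact hφ.const_mul _
  have hΦ : 0 ≤ ∫ x, φ₂ x ∂ν := integral_nonneg fun x => by rw [← hφ₂]; exact sq_nonneg _
  have hΨ : 0 ≤ ∫ x, ψ₂ x ∂ν := integral_nonneg fun x => by rw [← hψ₂]; exact sq_nonneg _
  rcases hΦ.lt_or_eq with hpos | hzero
  · have h := key (∫ x, φ x * ψ x ∂ν) (∫ x, φ₂ x ∂ν)
    nlinarith
  · rw [← hzero, zero_mul]
    by_contra hne
    have hC : (∫ x, φ x * ψ x ∂ν) ≠ 0 := fun h => hne (by rw [h]; norm_num)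
    set C : ℝ := ∫ x, φ x * ψ x ∂ν with hCdef
    set Ψ : ℝ := ∫ x, ψ₂ x ∂ν with hΨdef
    have h := key ((Ψ + 1) / (2 * C)) 1
    rw [← hzero] at h
    have e : 2 * ((Ψ + 1) / (2 * C)) * 1 * C = Ψ + 1 := by field_simp
    rw [mul_zero, e] at h
    linarith

/-- **Variance inequality** `(∫ h)² ≤ ∫ h₂` on a probability space, whenever `h² = h₂` pointwise. -/
theorem sq_integral_le [IsProbabilityMeasure ν] {h h₂ : Ω → ℝ} (hh₂ : ∀ x, h x ^ 2 = h₂ x)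
    (hh : Integrable h ν) (hk : Integrable h₂ ν) : (∫ x, h x ∂ν) ^ 2 ≤ ∫ x, h₂ x ∂ν := by
  have := sq_integral_mul_le (ν := ν) (φ := h) (ψ := fun _ => (1 : ℝ)) (φ₂ := h₂) (ψ₂ := fun _ => (1 : ℝ))
    hh₂ (fun _ => by norm_num) hk (integrable_const _) (by simpa only [mul_one] using hh)
  simpa using this

/-- `h ∈ L²` from the integrability of (a pointwise reshaping of) `h²`. -/
theorem memLp_two_of_sq_eq {h k : Ω → ℝ} (hm : AEStronglyMeasurable h ν) (hk : Integrable k ν)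
    (hhk : ∀ x, h x ^ 2 = k x) : MemLp h 2 ν := by
  rw [memLp_two_iff_integrable_sq hm]
  have : (fun x => h x ^ 2) = k := funext hhk
  rw [this]
  exact hk

/-- `L² · L² ⊆ L¹`. -/
theorem integrable_mul_of_memLp_two {h₁ h₂ : Ω → ℝ} (h1 : MemLp h₁ 2 ν) (h2 : MemLp h₂ 2 ν) :
    Integrable (fun x => h₁ x * h₂ x) ν :=
  h1.integrable_mul h2

end Integrals

/-! ## 3. Real-variable bookkeeping (kept outside the measure-theoretic context) -/

/-- Pointwise: `|(e^t − 1 − t)·y| ≤ ½ |y| t² e^{|t|}`. -/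
theorem abs_expRem_mul_le (t y : ℝ) :
    |(Real.exp t - 1 - t) * y| ≤ 1 / 2 * (|y| * (t ^ 2 * Real.exp |t|)) := by
  rw [abs_mul]
  calc |Real.exp t - 1 - t| * |y| ≤ (t ^ 2 / 2 * Real.exp |t|) * |y| :=
        mul_le_mul_of_nonneg_right (abs_exp_sub_one_sub_le t) (abs_nonneg y)
    _ = 1 / 2 * (|y| * (t ^ 2 * Real.exp |t|)) := by ring

/-- `|p(1/Z − 1) + q/Z − rs/Z²| ≤ |p|(Z − 1) + |q| + |r||s|` for `Z ≥ 1`. -/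
theorem abs_expansion_le {Z : ℝ} (p q r s : ℝ) (hZ : 1 ≤ Z) :
    |p * (1 / Z - 1) + q / Z - r * s / Z ^ 2| ≤ |p| * (Z - 1) + |q| + |r| * |s| := by
  have hZ_pos : 0 < Z := by linarith
  have hinv1 : 1 / Z ≤ 1 := (div_le_one hZ_pos).2 hZ
  have hinvZ : 0 ≤ 1 - 1 / Z := by linarith
  have hinvZ' : 1 - 1 / Z ≤ Z - 1 := by
    have e : 1 / Z * (Z - 1) = 1 - 1 / Z := by field_simp
    rw [← e]
    nlinarith
  have t1 : |p * (1 / Z - 1)| ≤ |p| * (Z - 1) := by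
    rw [abs_mul]
    refine mul_le_mul_of_nonneg_left ?_ (abs_nonneg _)
    rw [abs_sub_comm, abs_of_nonneg hinvZ]
    exact hinvZ'
  have t2 : |q / Z| ≤ |q| := by
    rw [abs_div, abs_of_pos hZ_pos]
    exact div_le_self (abs_nonneg _) hZ
  have t3 : |r * s / Z ^ 2| ≤ |r| * |s| := by
    rw [abs_div, abs_mul, abs_of_pos (by positivity : (0:ℝ) < Z ^ 2)]
    exact div_le_self (by positivity) (by nlinarith)
  calc |p * (1 / Z - 1) + q / Z - r * s / Z ^ 2|
      ≤ |p * (1 / Z - 1) + q / Z| + |r * s / Z ^ 2| := abs_sub _ _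
    _ ≤ |p * (1 / Z - 1)| + |q / Z| + |r * s / Z ^ 2| := by
        have := abs_add_le (p * (1 / Z - 1)) (q / Z); linarith
    _ ≤ _ := by linarith

/-- **The numerical bookkeeping.**  From the squared Cauchy–Schwarz inequalities between the moments (hypotheses `c_*`),
the remainder bounds and `Z − 1 ≤ ½ ∫Q`, the expansion is at most `4·A^{1/4} B^{1/4} W^{1/4} X^{1/2}` (in fact `15/4`);
here `A = ∫F⁴, B = ∫G⁴, W = ∫V⁸ ≤ 1, X = ∫e^{4|V|} ≥ 1`. Pure real arithmetic. -/
theorem tiltedCov_bookkeeping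
    {A B W X a2 b2 v2 v4 f2g2 m2 q1 r1 rF rG νFG I3 fv gv ρFG ρF ρG Z : ℝ}
    (hA0 : 0 ≤ A) (hB0 : 0 ≤ B) (hW0 : 0 ≤ W) (hW1 : W ≤ 1) (hX1 : 1 ≤ X)
    (ha2_0 : 0 ≤ a2) (hb2_0 : 0 ≤ b2) (hv2_0 : 0 ≤ v2) (hm2_0 : 0 ≤ m2)
    (c_fg : νFG ^ 2 ≤ a2 * b2) (c_a2 : a2 ^ 2 ≤ A) (c_b2 : b2 ^ 2 ≤ B) (c_I3 : I3 ^ 2 ≤ f2g2 * v2)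
    (c_f2g2 : f2g2 ^ 2 ≤ A * B) (c_v2 : v2 ^ 2 ≤ v4) (c_v4 : v4 ^ 2 ≤ W) (c_q1 : q1 ^ 2 ≤ m2)
    (c_m2 : m2 ^ 2 ≤ W * X) (c_r1 : r1 ^ 2 ≤ f2g2 * m2) (c_fv : fv ^ 2 ≤ a2 * v2) (c_gv : gv ^ 2 ≤ b2 * v2)
    (c_rF : rF ^ 2 ≤ a2 * m2) (c_rG : rG ^ 2 ≤ b2 * m2)
    (hZ1 : 1 ≤ Z) (hZq : Z - 1 ≤ 1 / 2 * q1)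
    (hρFG : |ρFG| ≤ 1 / 2 * r1) (hρF : |ρF| ≤ 1 / 2 * rF) (hρG : |ρG| ≤ 1 / 2 * rG) :
    |νFG + I3| * (Z - 1) + |ρFG| + |fv + ρF| * |gv + ρG| ≤
      4 * A ^ (1 / 4 : ℝ) * B ^ (1 / 4 : ℝ) * W ^ (1 / 4 : ℝ) * X ^ (1 / 2 : ℝ) := by
  have hX0 : 0 ≤ X := by linarith
  set α : ℝ := A ^ (1 / 4 : ℝ) with hα
  set β : ℝ := B ^ (1 / 4 : ℝ) with hβ
  set w : ℝ := W ^ (1 / 4 : ℝ) with hw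
  set x : ℝ := X ^ (1 / 4 : ℝ) with hx
  have hα0 : 0 ≤ α := Real.rpow_nonneg hA0 _
  have hβ0 : 0 ≤ β := Real.rpow_nonneg hB0 _
  have hw0 : 0 ≤ w := Real.rpow_nonneg hW0 _
  have hx0 : 0 ≤ x := Real.rpow_nonneg hX0 _
  have hα4 : α ^ 4 = A := by rw [hα, ← Real.rpow_natCast, ← Real.rpow_mul hA0]; norm_num
  have hβ4 : β ^ 4 = B := by rw [hβ, ← Real.rpow_natCast, ← Real.rpow_mul hB0]; norm_num
  have hw4 : w ^ 4 = W := by rw [hw, ← Real.rpow_natCast, ← Real.rpow_mul hW0]; norm_num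
  have hx4 : x ^ 4 = X := by rw [hx, ← Real.rpow_natCast, ← Real.rpow_mul hX0]; norm_num
  have hX2 : X ^ (1 / 2 : ℝ) = x ^ 2 := by rw [hx, ← Real.rpow_natCast, ← Real.rpow_mul hX0]; norm_num
  have hw1 : w ≤ 1 := Real.rpow_le_one hW0 hW1 (by norm_num)
  have hx1 : 1 ≤ x := Real.one_le_rpow hX1 (by norm_num)
  rw [hX2]
  -- root extraction
  have ha2 : a2 ≤ α ^ 2 :=
    le_of_sq_le_sq (c_a2.trans_eq (by rw [← hα4]; ring)) (sq_nonneg α)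
  have hb2 : b2 ≤ β ^ 2 :=
    le_of_sq_le_sq (c_b2.trans_eq (by rw [← hβ4]; ring)) (sq_nonneg β)
  have hv4' : v4 ≤ w ^ 2 :=
    le_of_sq_le_sq (c_v4.trans_eq (by rw [← hw4]; ring)) (sq_nonneg w)
  have hv2' : v2 ≤ w := le_of_sq_le_sq (c_v2.trans hv4') hw0
  have hv2'' : v2 ≤ 1 := hv2'.trans hw1
  have hf2g2 : f2g2 ≤ α ^ 2 * β ^ 2 :=
    le_of_sq_le_sq (c_f2g2.trans_eq (by rw [← hα4, ← hβ4]; ring)) (by positivity)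
  have hm2 : m2 ≤ w ^ 2 * x ^ 2 :=
    le_of_sq_le_sq (c_m2.trans_eq (by rw [← hw4, ← hx4]; ring)) (by positivity)
  have hq1 : q1 ≤ w * x :=
    le_of_sq_le_sq (c_q1.trans (hm2.trans_eq (by ring))) (by positivity)
  have hab2 : a2 * b2 ≤ α ^ 2 * β ^ 2 := mul_le_mul ha2 hb2 hb2_0 (sq_nonneg α)
  have e_fg : |νFG| ≤ α * β :=
    abs_le_of_sq_le_sq (c_fg.trans (hab2.trans_eq (by ring))) (by positivity)
  have hfv2 : f2g2 * v2 ≤ α ^ 2 * β ^ 2 * 1 := mul_le_mul hf2g2 hv2'' hv2_0 (by positivity)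
  have e_I3 : |I3| ≤ α * β :=
    abs_le_of_sq_le_sq (c_I3.trans (hfv2.trans_eq (by ring))) (by positivity)
  have hfm : f2g2 * m2 ≤ (α ^ 2 * β ^ 2) * (w ^ 2 * x ^ 2) := mul_le_mul hf2g2 hm2 hm2_0 (by positivity)
  have e_r1 : r1 ≤ α * β * (w * x) :=
    le_of_sq_le_sq (c_r1.trans (hfm.trans_eq (by ring))) (by positivity)
  have ham : a2 * m2 ≤ α ^ 2 * (w ^ 2 * x ^ 2) := mul_le_mul ha2 hm2 hm2_0 (sq_nonneg α)
  have hbm : b2 * m2 ≤ β ^ 2 * (w ^ 2 * x ^ 2) := mul_le_mul hb2 hm2 hm2_0 (sq_nonneg β)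
  have e_rF : rF ≤ α * (w * x) :=
    le_of_sq_le_sq (c_rF.trans (ham.trans_eq (by ring))) (by positivity)
  have e_rG : rG ≤ β * (w * x) :=
    le_of_sq_le_sq (c_rG.trans (hbm.trans_eq (by ring))) (by positivity)
  have hav : a2 * v2 ≤ α ^ 2 * 1 := mul_le_mul ha2 hv2'' hv2_0 (sq_nonneg α)
  have hbv : b2 * v2 ≤ β ^ 2 * 1 := mul_le_mul hb2 hv2'' hv2_0 (sq_nonneg β)
  have e_fv : |fv| ≤ α := abs_le_of_sq_le_sq (c_fv.trans (hav.trans_eq (by ring))) hα0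
  have e_gv : |gv| ≤ β := abs_le_of_sq_le_sq (c_gv.trans (hbv.trans_eq (by ring))) hβ0
  have e_fvgv : |fv| * |gv| ≤ α * β * w := by
    have h0 : fv ^ 2 * gv ^ 2 ≤ (a2 * v2) * (b2 * v2) :=
      mul_le_mul c_fv c_gv (sq_nonneg _) (mul_nonneg ha2_0 hv2_0)
    have hprod : (a2 * v2) * (b2 * v2) ≤ (α ^ 2 * β ^ 2) * (v2 * v2) := by
      have e : (a2 * v2) * (b2 * v2) = (a2 * b2) * (v2 * v2) := by ring
      rw [e]
      exact mul_le_mul_of_nonneg_right hab2 (mul_nonneg hv2_0 hv2_0)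
    have h1 : (|fv| * |gv|) ^ 2 ≤ (α * β * v2) ^ 2 := by
      rw [mul_pow, sq_abs, sq_abs]
      exact (h0.trans hprod).trans_eq (by ring)
    have h2 : |fv| * |gv| ≤ α * β * v2 := le_of_sq_le_sq h1 (by positivity)
    exact h2.trans (mul_le_mul_of_nonneg_left hv2' (mul_nonneg hα0 hβ0))
  -- assembling
  have hZm1 : 0 ≤ Z - 1 := by linarith
  have hab : 0 ≤ α * β := mul_nonneg hα0 hβ0
  have s1 : |νFG + I3| * (Z - 1) ≤ (α * β + α * β) * (1 / 2 * (w * x)) :=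
    mul_le_mul ((abs_add_le _ _).trans (add_le_add e_fg e_I3)) (hZq.trans (by linarith [hq1])) hZm1
      (by positivity)
  have s2 : |ρFG| ≤ 1 / 2 * (α * β * (w * x)) := hρFG.trans (by linarith [e_r1])
  have hρF' : |ρF| ≤ 1 / 2 * (α * (w * x)) := hρF.trans (by linarith [e_rF])
  have hρG' : |ρG| ≤ 1 / 2 * (β * (w * x)) := hρG.trans (by linarith [e_rG])
  have s3 : |fv + ρF| * |gv + ρG| ≤
      α * β * w + α * (1 / 2 * (β * (w * x))) + 1 / 2 * (α * (w * x)) * β +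
        1 / 2 * (α * (w * x)) * (1 / 2 * (β * (w * x))) := by
    have p0 : |fv + ρF| * |gv + ρG| ≤ (|fv| + |ρF|) * (|gv| + |ρG|) :=
      mul_le_mul (abs_add_le _ _) (abs_add_le _ _) (abs_nonneg _) (by positivity)
    have p2 : |fv| * |ρG| ≤ α * (1 / 2 * (β * (w * x))) := mul_le_mul e_fv hρG' (abs_nonneg _) hα0
    have p3 : |ρF| * |gv| ≤ 1 / 2 * (α * (w * x)) * β :=
      mul_le_mul hρF' e_gv (abs_nonneg _) (by positivity)
    have p4 : |ρF| * |ρG| ≤ 1 / 2 * (α * (w * x)) * (1 / 2 * (β * (w * x))) :=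
      mul_le_mul hρF' hρG' (abs_nonneg _) (by positivity)
    calc |fv + ρF| * |gv + ρG| ≤ (|fv| + |ρF|) * (|gv| + |ρG|) := p0
      _ = |fv| * |gv| + |fv| * |ρG| + |ρF| * |gv| + |ρF| * |ρG| := by ring
      _ ≤ _ := by linarith [e_fvgv, p2, p3, p4]
  have hwx : w * w ≤ w := mul_le_of_le_one_left hw0 hw1
  have k1 : 1 / 4 * (α * β) * (w * w) * x ^ 2 ≤ 1 / 4 * (α * β) * w * x ^ 2 := by
    have := mul_le_mul_of_nonneg_left hwx (by positivity : (0:ℝ) ≤ 1 / 4 * (α * β))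
    exact mul_le_mul_of_nonneg_right this (sq_nonneg x)
  have hpoly : 1 + 5 / 2 * x + 1 / 4 * x ^ 2 ≤ 4 * x ^ 2 := by
    have h' : 0 ≤ x ^ 2 - 2 * x + 1 := by
      have e : x ^ 2 - 2 * x + 1 = (x - 1) ^ 2 := by ring
      rw [e]; exact sq_nonneg _
    linarith
  have k2 : α * β * w * (1 + 5 / 2 * x + 1 / 4 * x ^ 2) ≤ α * β * w * (4 * x ^ 2) :=
    mul_le_mul_of_nonneg_left hpoly (mul_nonneg hab hw0)
  calc |νFG + I3| * (Z - 1) + |ρFG| + |fv + ρF| * |gv + ρG|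
      ≤ (α * β + α * β) * (1 / 2 * (w * x)) + 1 / 2 * (α * β * (w * x)) +
          (α * β * w + α * (1 / 2 * (β * (w * x))) + 1 / 2 * (α * (w * x)) * β +
            1 / 2 * (α * (w * x)) * (1 / 2 * (β * (w * x)))) := add_le_add (add_le_add s1 s2) s3
    _ = α * β * w * (1 + 5 / 2 * x) + 1 / 4 * (α * β) * (w * w) * x ^ 2 := by ring
    _ ≤ α * β * w * (1 + 5 / 2 * x) + 1 / 4 * (α * β) * w * x ^ 2 := by linarith [k1]
    _ = α * β * w * (1 + 5 / 2 * x + 1 / 4 * x ^ 2) := by ring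
    _ ≤ α * β * w * (4 * x ^ 2) := k2
    _ = 4 * α * β * w * x ^ 2 := by ring

end Summit.QuantumFields.YangMills.Theorems.AllWindowsColdBoxTiltedCov

end
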